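import Summits.Ventures.Crystal3D.Theorems.StickyWulffConstantGenericWallFloorCommonSlots
import Summits.Ventures.Crystal3D.Theorems.StickyWulffConstantGenericWallFloorCoaxialIff
import Summits.Ventures.Crystal3D.Theorems.StickyWulffConstantGenericWallFloorTwinAxis
import Summits.Ventures.Crystal3D.Theorems.StickyWulffConstantGenericWallFloorMixedDozenRules
import HarnessLib

/-!
# Two rigid fcc lattices sharing three linearly independent unit vectors coincide
# (crux `GenericWallFloor`, line `WallLedgerG`; E2 single-dozen algebra, lattice form)

HONEST FRAMING. Part of the venture `Summits/Ventures/Crystal3D` (cell `crystal3d-full`), helper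
`--supports` the crux `GenericWallFloor` (stmt-Ventures-19480) of `route-Ventures-StickyWulffConstant`,
registered line `WallLedgerG` (planner cf-p1 gen 16/22), open stub `stub_twoSlabAdhesion` — general-filling
step, per-ball programme E2 (cf-p1 ROUTE.md §80(6)–(9): «single-dozen lattice algebra»).

**`movedFcc_eq_of_three_independent_units`.**  If the linear lattices `A₁·Λ₀` and `A₂·Λ₀`
(`Λ₀ = fccStacking 1 √(2/3)`) have three LINEARLY INDEPENDENT unit vectors in common, they are EQUAL.
Proof, from the tree: two independent common unit vectors are neither equal nor antipodal, so the pair is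
co-axial (`common_slots_antipodal_of_not_coaxial`, `…CommonSlots`); a co-axial pair of different linear
lattices is a mirror-twin pair `L·Λ₀, L·Λ₀⁻` (`twin_of_coaxial_of_ne`, `…CoaxialIff`); and the common unit
vectors of `Λ₀` and `Λ₀⁻` are horizontal (`apply_two_eq_zero_of_mem_fcc_inter_twin`, `…TwinAxis`), hence
coplanar — contradicting independence (`not_linearIndependent_of_apply_two_eq_zero`).

This is the lattice form of the DOZEN RIGIDITY used by E2 (sequel `…GenericWallFloorSlotDozens`): a
close-packed dozen sharing three independent slots with a grain's slot dozen is that dozen (fcc type) or one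
of its eight twins (hcp type).  No `|O| ≥ 7` threshold is needed.

WHAT THIS IS NOT: nothing about packings or walls; rung F-C1 not moved.
-/

noncomputable section

namespace Summit.Ventures.Crystal3D.Theorems

open Literature.MathematicalPhysics.StatisticalMechanics
open scoped InnerProductSpace

/-! ### Linear-independence bookkeeping in `ℝ³` -/

/-- Three vectors of `ℝ³` with vanishing last coordinate are linearly dependent. -/
theorem not_linearIndependent_of_apply_two_eq_zero (v : Fin 3 → EuclideanSpace ℝ (Fin 3))
    (hv : ∀ i, v i 2 = 0) : ¬ LinearIndependent ℝ v := by
  intro h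
  rw [Fintype.linearIndependent_iff] at h
  have h0 := hv 0
  have h1 := hv 1
  have h2 := hv 2
  -- the three `2 × 2` minors vanish
  have hC : v 0 0 * v 1 1 - v 0 1 * v 1 0 = 0 := by
    have := h ![v 1 0 * v 2 1 - v 1 1 * v 2 0, v 2 0 * v 0 1 - v 2 1 * v 0 0,
      v 0 0 * v 1 1 - v 0 1 * v 1 0] (by
        ext j
        simp only [Fin.sum_univ_three, Matrix.cons_val_zero, Matrix.cons_val_one, Matrix.cons_val,
          PiLp.add_apply, PiLp.smul_apply, smul_eq_mul, PiLp.zero_apply]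
        fin_cases j
        · simp only [Fin.zero_eta, Fin.isValue]; ring
        · simp only [Fin.mk_one, Fin.isValue]; ring
        · simp only [Fin.reduceFinMk, Fin.isValue, h0, h1, h2]; ring) 2
    simpa using this
  -- hence `v₁₀ • v₀ − v₀₀ • v₁ = 0` and `v₁₁ • v₀ − v₀₁ • v₁ = 0`
  have hA : v 1 0 = 0 ∧ v 0 0 = 0 := by
    have key := h ![v 1 0, -v 0 0, 0] (by
        ext j
        simp only [Fin.sum_univ_three, Matrix.cons_val_zero, Matrix.cons_val_one, Matrix.cons_val,
          PiLp.add_apply, PiLp.smul_apply, smul_eq_mul, PiLp.zero_apply]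
        fin_cases j
        · simp only [Fin.zero_eta, Fin.isValue]; ring
        · simp only [Fin.mk_one, Fin.isValue]; linear_combination (-1 : ℝ) * hC
        · simp only [Fin.reduceFinMk, Fin.isValue, h0, h1, h2]; ring)
    have e0 := key 0
    have e1 := key 1
    simp only [Matrix.cons_val_zero, Matrix.cons_val_one, neg_eq_zero] at e0 e1
    exact ⟨e0, e1⟩
  have hB : v 1 1 = 0 ∧ v 0 1 = 0 := by
    have key := h ![v 1 1, -v 0 1, 0] (by
        ext j
        simp only [Fin.sum_univ_three, Matrix.cons_val_zero, Matrix.cons_val_one, Matrix.cons_val,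
          PiLp.add_apply, PiLp.smul_apply, smul_eq_mul, PiLp.zero_apply]
        fin_cases j
        · simp only [Fin.zero_eta, Fin.isValue]; linear_combination hC
        · simp only [Fin.mk_one, Fin.isValue]; ring
        · simp only [Fin.reduceFinMk, Fin.isValue, h0, h1, h2]; ring)
    have e0 := key 0
    have e1 := key 1
    simp only [Matrix.cons_val_zero, Matrix.cons_val_one, neg_eq_zero] at e0 e1
    exact ⟨e0, e1⟩
  -- so `v₀ = 0`, contradicting independence
  have hz : v 0 = 0 := by
    ext j
    fin_cases j
    · simpa using hA.2
    · simpa using hB.2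
    · simpa using h0
  have := h ![1, 0, 0] (by
      simp only [Fin.sum_univ_three, Matrix.cons_val_zero, Matrix.cons_val_one, Matrix.cons_val, hz,
        smul_zero, zero_smul, add_zero]) 0
  simp at this

/-- Members of a linearly independent triple are neither equal nor antipodal. -/
theorem ne_and_ne_neg_of_linearIndependent {a b c : EuclideanSpace ℝ (Fin 3)}
    (h : LinearIndependent ℝ ![a, b, c]) : b ≠ a ∧ b ≠ -a := by
  rw [Fintype.linearIndependent_iff] at h
  constructor
  · intro hba
    have := h ![1, -1, 0] (by simp [Fin.sum_univ_three, hba]) 0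
    simp at this
  · intro hba
    have := h ![1, 1, 0] (by simp [Fin.sum_univ_three, hba]) 0
    simp at this

/-- A linear isometric equivalence preserves linear independence of a triple. -/
theorem linearIndependent_map_triple (L : EuclideanSpace ℝ (Fin 3) ≃ₗᵢ[ℝ] EuclideanSpace ℝ (Fin 3))
    {a b c : EuclideanSpace ℝ (Fin 3)} (h : LinearIndependent ℝ ![a, b, c]) :
    LinearIndependent ℝ ![L a, L b, L c] := by
  have e : (![L a, L b, L c] : Fin 3 → EuclideanSpace ℝ (Fin 3)) =
      L.toLinearEquiv.toLinearMap ∘ ![a, b, c] := by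
    ext i : 1
    fin_cases i <;> rfl
  rw [e]
  exact h.map' _ L.toLinearEquiv.ker

/-! ### The rigidity theorem -/

/-- **Two rigid fcc lattices sharing three linearly independent unit vectors are EQUAL** (as linear
lattices).  Threshold-free lattice form of the E2 dozen rigidity. -/
theorem movedFcc_eq_of_three_independent_units
    (A₁ A₂ : EuclideanSpace ℝ (Fin 3) ≃ₗᵢ[ℝ] EuclideanSpace ℝ (Fin 3)) {a b c : EuclideanSpace ℝ (Fin 3)}
    (ha₁ : a ∈ A₁ '' fccStacking 1 (Real.sqrt (2 / 3))) (hb₁ : b ∈ A₁ '' fccStacking 1 (Real.sqrt (2 / 3)))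
    (hc₁ : c ∈ A₁ '' fccStacking 1 (Real.sqrt (2 / 3)))
    (ha₂ : a ∈ A₂ '' fccStacking 1 (Real.sqrt (2 / 3))) (hb₂ : b ∈ A₂ '' fccStacking 1 (Real.sqrt (2 / 3)))
    (hc₂ : c ∈ A₂ '' fccStacking 1 (Real.sqrt (2 / 3)))
    (ha : ‖a‖ = 1) (hb : ‖b‖ = 1) (hc : ‖c‖ = 1) (hind : LinearIndependent ℝ ![a, b, c]) :
    A₁ '' fccStacking 1 (Real.sqrt (2 / 3)) = A₂ '' fccStacking 1 (Real.sqrt (2 / 3)) := by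
  by_contra hne
  obtain ⟨hba, hba'⟩ := ne_and_ne_neg_of_linearIndependent hind
  -- two independent common slots force co-axiality
  have hcoax : ∃ (L' : EuclideanSpace ℝ (Fin 3) ≃ₗᵢ[ℝ] EuclideanSpace ℝ (Fin 3))
      (s₁ s₂ : EuclideanSpace ℝ (Fin 3)) (σ σ' : ℤ → ℤ), IsHaggSeq σ ∧ IsHaggSeq σ' ∧
      (fun p => A₁ p + 0) '' fccStacking 1 (Real.sqrt (2 / 3)) ⊆
        (fun p => L' p + s₁) '' barlowStacking 1 (Real.sqrt (2 / 3)) σ ∧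
      (fun p => A₂ p + 0) '' fccStacking 1 (Real.sqrt (2 / 3)) ⊆
        (fun p => L' p + s₂) '' barlowStacking 1 (Real.sqrt (2 / 3)) σ' := by
    by_contra hnc
    rcases common_slots_antipodal_of_not_coaxial A₁ A₂ 0 0 hnc ha₁ hb₁ ha₂ hb₂ ha hb with h | h
    · exact hba h
    · exact hba' h
  -- a co-axial pair of different lattices is a mirror-twin pair in a common frame `L`
  obtain ⟨L, hL⟩ := twin_of_coaxial_of_ne A₁ A₂ 0 0 hcoax hne
  -- in both cases the three common unit vectors pull back to `Λ₀ ∩ Λ₀⁻`, hence are horizontal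
  have horiz : ∀ x : EuclideanSpace ℝ (Fin 3), x ∈ A₁ '' fccStacking 1 (Real.sqrt (2 / 3)) →
      x ∈ A₂ '' fccStacking 1 (Real.sqrt (2 / 3)) → ‖x‖ = 1 → (L.symm x) 2 = 0 := by
    intro x hx₁ hx₂ hx1
    have pull : ∀ (S : Set (EuclideanSpace ℝ (Fin 3))), x ∈ L '' S → L.symm x ∈ S := by
      rintro S ⟨y, hy, rfl⟩
      simpa using hy
    have hn : ‖L.symm x‖ = 1 := by rw [LinearIsometryEquiv.norm_map, hx1]
    rcases hL with ⟨h₁, h₂⟩ | ⟨h₁, h₂⟩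
    · rw [h₁] at hx₁
      rw [h₂] at hx₂
      exact apply_two_eq_zero_of_mem_fcc_inter_twin (pull _ hx₁) (pull _ hx₂) hn
    · rw [h₁] at hx₁
      rw [h₂] at hx₂
      exact apply_two_eq_zero_of_mem_fcc_inter_twin (pull _ hx₂) (pull _ hx₁) hn
  have hind' := linearIndependent_map_triple L.symm hind
  refine not_linearIndependent_of_apply_two_eq_zero ![L.symm a, L.symm b, L.symm c] ?_ hind'
  intro i
  fin_cases i
  · exact horiz a ha₁ ha₂ ha
  · exact horiz b hb₁ hb₂ hb
  · exact horiz c hc₁ hc₂ hc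

/-- **Slot form.**  If three linearly independent slots `A₁ w` (`w ∈ fccSlots`) of one rigid fcc lattice
are unit vectors of another, the two linear lattices are equal. -/
theorem movedFcc_eq_of_three_independent_slots
    (A₁ A₂ : EuclideanSpace ℝ (Fin 3) ≃ₗᵢ[ℝ] EuclideanSpace ℝ (Fin 3))
    {w₁ w₂ w₃ : EuclideanSpace ℝ (Fin 3)} (hw₁ : w₁ ∈ fccSlots) (hw₂ : w₂ ∈ fccSlots) (hw₃ : w₃ ∈ fccSlots)
    (h₁ : A₁ w₁ ∈ A₂ '' fccStacking 1 (Real.sqrt (2 / 3)))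
    (h₂ : A₁ w₂ ∈ A₂ '' fccStacking 1 (Real.sqrt (2 / 3)))
    (h₃ : A₁ w₃ ∈ A₂ '' fccStacking 1 (Real.sqrt (2 / 3)))
    (hind : LinearIndependent ℝ ![w₁, w₂, w₃]) :
    A₁ '' fccStacking 1 (Real.sqrt (2 / 3)) = A₂ '' fccStacking 1 (Real.sqrt (2 / 3)) :=
  movedFcc_eq_of_three_independent_units A₁ A₂
    ⟨w₁, mem_fcc_of_mem_fccSlots hw₁, rfl⟩ ⟨w₂, mem_fcc_of_mem_fccSlots hw₂, rfl⟩
    ⟨w₃, mem_fcc_of_mem_fccSlots hw₃, rfl⟩ h₁ h₂ h₃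
    (by rw [LinearIsometryEquiv.norm_map, norm_eq_one_of_mem_fccSlots hw₁])
    (by rw [LinearIsometryEquiv.norm_map, norm_eq_one_of_mem_fccSlots hw₂])
    (by rw [LinearIsometryEquiv.norm_map, norm_eq_one_of_mem_fccSlots hw₃])
    (linearIndependent_map_triple A₁ hind)

end Summit.Ventures.Crystal3D.Theorems

end
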